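import Literature.Analysis.PDE.WeakHarnackPointwise
import HarnessLib

/-!
# The auxiliary functions `w_k = h_k + ε v` of Evans–Krylov (Gilbarg–Trudinger (17.47)–(17.48))

Pointwise algebra of GT p. 460: given, at one point, an elliptic matrix `a ≥ λ`, finitely many
functions `h_k` with values in `[0,1]`, gradients `g_k` and Hessians `H_k` satisfying the one-sided
bounds `-a : H_k ≤ A D + B` (`D ≥ 0` the size of the third derivatives) and the Motzkin–Wasow
control `D² ≤ M Σ_k |g_k|²`, the Hessian `H_v = Σ_k (2 h_k H_k + 2 g_k g_kᵀ)` of `v = Σ h_k²`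
satisfies `a : H_v ≥ -2N(AD + B) + 2λ Σ|g_k|²` (`pair_hessian_v_ge`, GT (17.47)), and
`w_k = h_k + ε v` satisfies the two-sided-free bound
`a : (H_k + ε H_v) ≥ -[(1 + 2εN) B + (1 + 2εN)² A² M/(8ελ)]` (`pair_hessian_w_ge`, GT (17.48):
"`F_{ij}D_{ij}w ≥ -λμ̄`"), by the Cauchy inequality.

## References

* D. Gilbarg, N. S. Trudinger, *Elliptic Partial Differential Equations of Second Order* (2001),
  §17.4, (17.47)–(17.48). [GilbargTrudinger2001]
-/

noncomputable section

open Matrix Finset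

namespace Literature.Analysis.PDE.EvansKrylov

open Literature.Analysis.PDE.KrylovSafonov

variable {ι : Type*} [Fintype ι] [DecidableEq ι] {K : Type*} [Fintype K]

omit [DecidableEq ι] [Fintype K] in
/-- `pair` distributes over finite sums. [folklore] -/
theorem pair_sum (a : Matrix ι ι ℝ) (H : K → Matrix ι ι ℝ) (s : Finset K) :
    pair a (∑ k ∈ s, H k) = ∑ k ∈ s, pair a (H k) := by
  classical
  induction s using Finset.induction_on with
  | empty => simp [pair]
  | insert k s hk ih => rw [Finset.sum_insert hk, Finset.sum_insert hk, pair_add, ih]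

omit [DecidableEq ι] in
/-- **(17.47)**: the Hessian of `v = Σ h_k²` pairs as
`a : H_v ≥ -2 Σ_k h_k (AD + B) + 2λ Σ_k |g_k|² ≥ -2N(AD+B) + 2λ Σ|g_k|²`.
[cite: GilbargTrudinger2001, (17.47)] -/
theorem pair_hessian_v_ge {a : Matrix ι ι ℝ} {lam : ℝ}
    (hlam : ∀ ξ : ι → ℝ, lam * (ξ ⬝ᵥ ξ) ≤ ξ ⬝ᵥ (a *ᵥ ξ)) {h : K → ℝ} (h0 : ∀ k, 0 ≤ h k)
    (h1 : ∀ k, h k ≤ 1) {g : K → ι → ℝ} {H : K → Matrix ι ι ℝ} {A D B : ℝ} (hA : 0 ≤ A) (hD : 0 ≤ D)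
    (hB : 0 ≤ B) (hH : ∀ k, -pair a (H k) ≤ A * D + B) :
    -(2 * Fintype.card K * (A * D + B)) + 2 * lam * ∑ k, g k ⬝ᵥ g k ≤
      pair a (∑ k, ((2 * h k) • H k + (2 : ℝ) • vecMulVec (g k) (g k))) := by
  rw [pair_sum]
  have hterm : ∀ k, -(2 * (A * D + B)) + 2 * lam * (g k ⬝ᵥ g k) ≤
      pair a ((2 * h k) • H k + (2 : ℝ) • vecMulVec (g k) (g k)) := fun k ↦ by
    rw [pair_add, pair_smul, pair_smul, pair_vecMulVec]
    have e1 : -(A * D + B) ≤ pair a (H k) := by linarith [hH k]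
    have e2 : 2 * h k * -(A * D + B) ≤ 2 * h k * pair a (H k) :=
      mul_le_mul_of_nonneg_left e1 (by linarith [h0 k])
    have e3 : -(2 * (A * D + B)) ≤ 2 * h k * -(A * D + B) := by
      have : 0 ≤ A * D + B := by positivity
      nlinarith [h1 k, h0 k]
    have e4 := hlam (g k)
    nlinarith
  calc -(2 * Fintype.card K * (A * D + B)) + 2 * lam * ∑ k, g k ⬝ᵥ g k
      = ∑ k : K, (-(2 * (A * D + B)) + 2 * lam * (g k ⬝ᵥ g k)) := by
        rw [Finset.sum_add_distrib, Finset.sum_const, Finset.card_univ, ← Finset.mul_sum]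
        simp; ring
    _ ≤ ∑ k, pair a ((2 * h k) • H k + (2 : ℝ) • vecMulVec (g k) (g k)) :=
        Finset.sum_le_sum fun k _ ↦ hterm k

omit [DecidableEq ι] in
/-- **(17.48)**: with `D² ≤ M Σ|g_k|²` (Motzkin–Wasow control of the third derivatives) and
`ε > 0`, the function `w_k = h_k + εv` satisfies
`a : (H_k + ε H_v) ≥ -[(1 + 2εN)B + (1 + 2εN)² A² M/(8ελ)]` — no `D` on the right.
[cite: GilbargTrudinger2001, (17.48) ("and hence, by the Cauchy inequality, F_{ij}D_{ij}w ≥ -λμ̄")] -/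
theorem pair_hessian_w_ge {a : Matrix ι ι ℝ} {lam : ℝ} (hlam0 : 0 < lam)
    (hlam : ∀ ξ : ι → ℝ, lam * (ξ ⬝ᵥ ξ) ≤ ξ ⬝ᵥ (a *ᵥ ξ)) {h : K → ℝ} (h0 : ∀ k, 0 ≤ h k)
    (h1 : ∀ k, h k ≤ 1) {g : K → ι → ℝ} {H : K → Matrix ι ι ℝ} {A D B M : ℝ} (hA : 0 ≤ A)
    (hD : 0 ≤ D) (hB : 0 ≤ B) (hM : 0 < M) (hH : ∀ k, -pair a (H k) ≤ A * D + B)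
    (hMW : D ^ 2 ≤ M * ∑ k, g k ⬝ᵥ g k) {ε : ℝ} (hε : 0 < ε) (k : K) :
    -((1 + 2 * ε * Fintype.card K) * B + (1 + 2 * ε * Fintype.card K) ^ 2 * A ^ 2 * M / (8 * ε * lam)) ≤
      pair a (H k + ε • ∑ l, ((2 * h l) • H l + (2 : ℝ) • vecMulVec (g l) (g l))) := by
  rw [pair_add, pair_smul]
  have hv := pair_hessian_v_ge hlam h0 h1 hA hD hB hH (g := g) (H := H)
  set S := ∑ l, g l ⬝ᵥ g l with hS
  set Nr : ℝ := (Fintype.card K : ℝ) with hNr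
  have hk := hH k
  have hN0 : 0 ≤ Nr := by rw [hNr]; positivity
  -- `pair ≥ -(1+2εN)(AD+B) + 2ελ S ≥ -(1+2εN)(AD+B) + 2ελ D²/M`
  have step1 : -((1 + 2 * ε * Nr) * (A * D + B)) + 2 * ε * lam * S ≤
      pair a (H k) + ε * pair a (∑ l, ((2 * h l) • H l + (2 : ℝ) • vecMulVec (g l) (g l))) := by
    have := mul_le_mul_of_nonneg_left hv hε.le
    nlinarith
  have step2 : 2 * ε * lam * (D ^ 2 / M) ≤ 2 * ε * lam * S := by
    refine mul_le_mul_of_nonneg_left ?_ (by positivity)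
    rw [div_le_iff₀ hM]; linarith
  -- Cauchy: `t D ≤ c D² + t²/(4c)` with `c = 2ελ/M`, `t = (1+2εN)A`
  set t := (1 + 2 * ε * Nr) * A with ht
  set c := 2 * ε * lam / M with hc
  have hc0 : 0 < c := by positivity
  have cauchy : t * D ≤ c * D ^ 2 + t ^ 2 / (4 * c) := by
    have : 0 ≤ c * (D - t / (2 * c)) ^ 2 := by positivity
    have e : c * (D - t / (2 * c)) ^ 2 = c * D ^ 2 - t * D + t ^ 2 / (4 * c) := by
      field_simp; ring
    linarith
  have e2 : t ^ 2 / (4 * c) = (1 + 2 * ε * Nr) ^ 2 * A ^ 2 * M / (8 * ε * lam) := by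
    rw [ht, hc]; field_simp; ring
  have e3 : c * D ^ 2 = 2 * ε * lam * (D ^ 2 / M) := by rw [hc]; field_simp
  rw [e2, e3] at cauchy
  have expand : (1 + 2 * ε * Nr) * (A * D + B) = t * D + (1 + 2 * ε * Nr) * B := by rw [ht]; ring
  rw [expand] at step1
  linarith

end Literature.Analysis.PDE.EvansKrylov

end
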